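import Literature.Barriers.ValiantsHypothesis.CT23EquationsForSmallCircuits
import Literature.Computability.AlgebraicComplexity.IMMInVPProofs
import Literature.Computability.AlgebraicComplexity.BurgisserBooleanParts
import Literature.Computability.AlgebraicComplexity.ValiantClasses
import Literature.Computability.AlgebraicComplexity.ValiantConjectureEquivProofs
import Literature.Computability.AlgebraicComplexity.KRSTSelection
import Literature.Computability.AlgebraicComplexity.ApolarityAction
import Literature.ModelTheory.FiniteModelTheory.SymmetricCircuitCountingWidthProofs
import Summits.ValiantsHypothesis.ValiantsHypothesis.Theorems.BarrierLeverNaturalProofsSeparateVNPSignSlice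
import Summits.ValiantsHypothesis.ValiantsHypothesis.Theorems.BarrierLeverDefinableEquationsBoolSumComponents

/-!
# Cruxes `DefinableEquations` (8745) / `DefinableDcEquations` (8746) / `SingleSizeEquations` (8749)
# of route BarrierLever — the ENGINE of "refuting the crux separates `VNP` from `VPSPACE⁰_b`"
# (Chatterjee–Tengse §4.3 second case, `𝒟 = VNP`; route-independent helper file, val-np-p5 g24)

Route-independent toolkit (no `Theses` import; consumed by
`…BarrierLeverDefinableEquationsVNPVersusVPSPACE.lean`, which applies it to the three cruxes).
Over any field `F` of characteristic `0`:

* §0 arithmetic (`#x^{≤ ⌊log₄ N⌋} ≤ N + 1`, level absorption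
  `(4^n)^e + e ≤ C(2n,n)^(2e+1)`);
* §1 `exists_coeffBoolSum_of_evalBoolSum` — **Chatterjee–Tengse Prop. 4.6 for BOOLEAN SUMS** (the
  Literature file `CT23LowerBoundsFromSuccinctHittingSets.lean` types Prop. 4.6 for `VP`-size
  equations and records "the `VNP` variant is not typed"): a Boolean-sum equation `boolSum H ≠ 0`
  for the EVALUATION vectors of a class of degree-`≤ d` polynomials pulls back — substituting the
  linear forms of the transposed simplex Vandermonde matrix `Vᵀ` into the coordinate block ONLY,
  Boolean block untouched (`boolSum_aeval_inl`) — to `boolSum H' = Vᵀ · boolSum H ≠ 0` vanishing at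
  the COEFFICIENT vectors, same Boolean block, `deg H' ≤ deg H`, `L(H') ≤ L(H) + 2N²`
  (`complexity_aeval_le`);
* §2 `exists_isVPSPACE0bFamily_not_isVNPFamily` — **the separation engine**: nonzero multilinear
  integer equations with constant-free fan-in-two PROJECTION circuits of size `≤ 2^n` for the
  evaluation vectors of classes `S n` (degree `≤ n`) whose coefficient vectors hit, for every level
  `a` and infinitely often in `n`, all nonzero level-`a` Boolean sums (`q, L(H), deg H ≤ C(2n,n)^a`)
  assemble — indexed by `N` with `n = ⌊log₄ N⌋`, zero below the thresholds — into an integer family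
  in `VPSPACE⁰_b` (`IsVPSPACE0bFamily`) whose image over `F` is NOT in `VNP_F` (`¬ IsVNPFamily`):
  a putative `VP` witness `g` with `P ⊗ F = boolSum g` is tested at `N = 4^n` for a hit level
  absorbing its p-bounds, and §1 pulls `boolSum (g (4^n)) = P_n ⊗ F` back to a hit Boolean-sum
  equation for the coefficient vectors — contradiction.  The `VNP` form of the tree's
  `exists_isVPSPACE0bFamily_not_isVPFamily_of_succinctHittingSetsForVP` (val-lit; there the
  hypothesis is `∀ a ∃ b` and a diagonal over `a` is needed — here the class is fixed and none is);
  `not_isVPFamily_of_not_isVNPFamily` moves it one class down (`VP ⊆ VNP`).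
HONEST READING: machinery for a calibration of what REFUTING the cruxes would prove; no lower
bound; the cruxes are OPEN; `VP ≠ VNP` is NOT proved.  No definitions, no named facts.

## References

* [ChatterjeeTengse2023] P. Chatterjee, A. Tengse, *Lower Bounds from Succinct Hitting Sets*,
  arXiv:2309.07612: Prop. 4.6 (v1 Prop. 49), Thm. 1.1 last clause and §4.3 (v1 p0019 L6–L8).
* [Burgisser2000] P. Bürgisser, *Completeness and Reduction in Algebraic Complexity Theory*,
  Def. 2.5 (Boolean sums, `IsVNPFamily`), Rem. 2.7 (substitution).
-/

-- `Summit.ValiantsHypothesis.ValiantsHypothesis.…` repeats a component by the D-0017 layout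
-- (single-conjunct summit), which the `dupNamespace` linter flags; the name is mandated.
set_option linter.dupNamespace false

noncomputable section

namespace Summit.ValiantsHypothesis.ValiantsHypothesis.Theorems.BarrierLeverDefinableEquations

open MvPolynomial
open Literature.Computability.AlgebraicComplexity Literature.Barriers.ValiantsHypothesis
open scoped BigOperators

namespace VNPVersusVPSPACE

/-! ## §0 Arithmetic helpers -/

/-- A multilinear polynomial has total degree at most the number of its variables. [folklore] -/
theorem totalDegree_le_card_of_degreeOf_le_one {σ R : Type*} [Fintype σ] [CommSemiring R]
    {P : MvPolynomial σ R} (h : ∀ v, P.degreeOf v ≤ 1) : P.totalDegree ≤ Fintype.card σ := by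
  classical
  rw [totalDegree]
  refine Finset.sup_le fun m hm => ?_
  have hmv : ∀ v, m v ≤ 1 := fun v => (degreeOf_le_iff.1 (h v)) m hm
  calc (m.sum fun _ e => e) = ∑ v ∈ m.support, m v := rfl
    _ ≤ ∑ v ∈ m.support, 1 := Finset.sum_le_sum fun v _ => hmv v
    _ = m.support.card := by simp
    _ ≤ Fintype.card σ := Finset.card_le_univ _

/-- `2^{⌊log₄ N⌋} ≤ N + 1`. [folklore] -/
theorem two_pow_log_four_le (N : ℕ) : 2 ^ Nat.log 4 N ≤ N + 1 := by
  rcases Nat.eq_zero_or_pos N with rfl | hN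
  · simp
  · exact ((Nat.pow_le_pow_left (by norm_num : 2 ≤ 4) _).trans
      (Nat.pow_log_le_self 4 hN.ne')).trans (Nat.le_succ N)

/-- `#x^{≤ ⌊log₄ N⌋} ≤ N + 1`. [folklore] -/
theorem card_degLEMonomials_log_le (N : ℕ) :
    Fintype.card (degLEMonomials (Nat.log 4 N)) ≤ N + 1 := by
  rw [BarrierLever.NaturalProofsSeparateVNP.SignSlice.fintypeCard_degLEMonomials]
  rcases Nat.eq_zero_or_pos N with rfl | hN
  · simp
  · calc (2 * Nat.log 4 N).choose (Nat.log 4 N) ≤ 2 ^ (2 * Nat.log 4 N) := Nat.choose_le_two_pow _ _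
      _ = 4 ^ Nat.log 4 N := by rw [pow_mul]; norm_num
      _ ≤ N := Nat.pow_log_le_self 4 hN.ne'
      _ ≤ N + 1 := Nat.le_succ N

/-- Absorbing a p-bound at `N = 4^n` into a level at `C(2n,n)`:
`(4^n)^e + e ≤ C(2n,n)^(2e+1)` for `n ≥ 1`. [folklore] -/
theorem bound_le_level {n : ℕ} (hn : 1 ≤ n) (e : ℕ) :
    (4 ^ n) ^ e + e ≤ ((2 * n).choose n) ^ (2 * e + 1) := by
  set C := (2 * n).choose n with hCdef
  have hC : 2 ^ n ≤ C := Literature.ModelTheory.FiniteModelTheory.two_pow_le_choose_two_mul_self n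
  have h2n : 2 ≤ 2 ^ n :=
    calc (2 : ℕ) = 2 ^ 1 := (pow_one 2).symm
      _ ≤ 2 ^ n := Nat.pow_le_pow_right (by norm_num) hn
  have hC2 : 2 ≤ C := h2n.trans hC
  have h4 : (4 ^ n) ^ e ≤ C ^ (2 * e) := by
    have : (4 : ℕ) ^ n = (2 ^ n) ^ 2 := by
      rw [← pow_mul, mul_comm, pow_mul]; norm_num
    rw [this, ← pow_mul]
    exact Nat.pow_le_pow_left hC _
  have he : e ≤ C ^ (2 * e) :=
    calc e ≤ 2 ^ e := Nat.lt_two_pow_self.le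
      _ ≤ C ^ e := Nat.pow_le_pow_left hC2 _
      _ ≤ C ^ (2 * e) := Nat.pow_le_pow_right (by omega) (by omega)
  calc (4 ^ n) ^ e + e ≤ C ^ (2 * e) + C ^ (2 * e) := Nat.add_le_add h4 he
    _ = 2 * C ^ (2 * e) := by ring
    _ ≤ C * C ^ (2 * e) := Nat.mul_le_mul_right _ hC2
    _ = C ^ (2 * e + 1) := by ring

/-- Level bookkeeping: `x ≤ C^A`, `A ≥ 1`, `C ≥ 2` give `x + 2 C² ≤ C^(A+3)`. [folklore] -/
theorem add_two_sq_le_pow {C A x : ℕ} (hC : 2 ≤ C) (hA : 1 ≤ A) (hx : x ≤ C ^ A) :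
    x + 2 * C ^ 2 ≤ C ^ (A + 3) := by
  have h1 : C ^ 2 ≤ C ^ (A + 1) := Nat.pow_le_pow_right (by omega) (by omega)
  have h2 : C ^ A ≤ C ^ (A + 1) := Nat.pow_le_pow_right (by omega) (by omega)
  have h3 : 3 ≤ C ^ 2 := by nlinarith
  calc x + 2 * C ^ 2 ≤ C ^ (A + 1) + 2 * C ^ (A + 1) := Nat.add_le_add (hx.trans h2) (by omega)
    _ = 3 * C ^ (A + 1) := by ring
    _ ≤ C ^ 2 * C ^ (A + 1) := Nat.mul_le_mul_right _ h3
    _ = C ^ (A + 3) := by ring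

/-! ## §1 Prop. 4.6 of Chatterjee–Tengse for BOOLEAN SUMS -/

section PropFourSix

variable (F : Type) [Field F]

/-- `(Mᵀ · p)(y) = p(M y)`: evaluating the linear substitution by `Mᵀ` at `y` is evaluating `p`
at `M.mulVec y` (the private `eval_linSubst` of `CT23LowerBoundsFromSuccinctHittingSets.lean`,
re-derived). [folklore] -/
theorem eval_linSubst_transpose {S : Type*} [Fintype S] (M : Matrix S S F) (y : S → F)
    (p : MvPolynomial S F) :
    eval y (linSubst S F M.transpose p) = eval (M.mulVec y) p := by
  -- adapted from `…BarrierLeverDefinableEquationsCT23Dichotomy.lean` §1 (route-independent copy)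
  have h : linSubst S F M.transpose p =
      bind₁ (fun i => ∑ j, M.transpose j i • (X j : MvPolynomial S F)) p := by
    simp [linSubst, aeval_eq_bind₁]
  rw [h]
  change eval₂Hom (RingHom.id F) y (bind₁ _ p) = _
  rw [eval₂Hom_bind₁]
  change eval (fun i => eval y (∑ j, M.transpose j i • (X j : MvPolynomial S F))) p = _
  have hfun : (fun i => eval y (∑ j, M.transpose j i • (X j : MvPolynomial S F))) = M.mulVec y := by
    funext i
    simp [smul_eval, Matrix.mulVec, dotProduct, Matrix.transpose_apply]
  rw [hfun]

/-- **Boolean-sum equations move from evaluation vectors to coefficient vectors** (the `VNP`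
variant of Chatterjee–Tengse Prop. 4.6).  If `boolSum H ≠ 0` (`H` in the `N = |x^{≤ d}|`
evaluation coordinates and `q` Boolean variables) vanishes at the evaluation vector
`evalVector F d f` of every `f ∈ 𝒞` (`deg f ≤ d`), then `H' := H ∘ (Vᵀ ⊕ id)` — the linear forms of
the transposed simplex Vandermonde matrix substituted into the coordinate variables only — has
`boolSum H' = Vᵀ · boolSum H ≠ 0`, vanishes at every COEFFICIENT vector `coeffVector f`, `f ∈ 𝒞`,
and satisfies `deg H' ≤ deg H`, `L(H') ≤ L(H) + 2N²`.
[cite: ChatterjeeTengse2023, Prop. 4.6 (v1: Prop. 49)] -/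
theorem exists_coeffBoolSum_of_evalBoolSum [CharZero F] {n d q : ℕ} [Fintype (monomialsDegLE n d)]
    (𝒞 : Set (MvPolynomial (Fin n) F)) (h𝒞 : ∀ f ∈ 𝒞, f.totalDegree ≤ d)
    (H : MvPolynomial (monomialsDegLE n d ⊕ Fin q) F) (hE0 : boolSum H ≠ 0)
    (hE : ∀ f ∈ 𝒞, eval (evalVector F d f) (boolSum H) = 0) :
    ∃ H' : MvPolynomial (monomialsDegLE n d ⊕ Fin q) F,
      boolSum H' ≠ 0 ∧ H'.totalDegree ≤ H.totalDegree ∧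
      complexity H' ≤ complexity H + 2 * Fintype.card (monomialsDegLE n d) ^ 2 ∧
      ∀ f ∈ 𝒞, eval (coeffVector (monomialsDegLE n d) f) (boolSum H') = 0 := by
  classical
  set V := simplexVandermonde F n d with hVdef
  have hVt : IsUnit V.transpose.det := by
    rw [Matrix.det_transpose]; exact isUnit_det_simplexVandermonde F n d
  -- the linear forms of `Vᵀ` and the substitution on the coordinate block only
  set ℓ : monomialsDegLE n d → MvPolynomial (monomialsDegLE n d) F :=
    fun i => ∑ j, V.transpose j i • X j with hℓ
  set θ : monomialsDegLE n d ⊕ Fin q → MvPolynomial (monomialsDegLE n d ⊕ Fin q) F :=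
    Sum.elim (fun i => rename Sum.inl (ℓ i)) (fun j => X (Sum.inr j)) with hθ
  have hkey : boolSum (aeval θ H) = linSubst _ F V.transpose (boolSum H) := by
    rw [hθ, BarrierLever.BoolSumComponents.boolSum_aeval_inl]
    rfl
  -- complexity of the linear forms
  have hℓcx : ∀ i, complexity (ℓ i) ≤ 2 * Fintype.card (monomialsDegLE n d) := by
    intro i
    calc complexity (∑ j, V.transpose j i • (X j : MvPolynomial (monomialsDegLE n d) F))
        ≤ ∑ j, complexity (V.transpose j i • (X j : MvPolynomial (monomialsDegLE n d) F)) +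
            (Finset.univ : Finset (monomialsDegLE n d)).card := complexity_finset_sum_le _ _
      _ ≤ ∑ _j : monomialsDegLE n d, 1 + (Finset.univ : Finset (monomialsDegLE n d)).card := by
          gcongr with j
          calc complexity (V.transpose j i • (X j : MvPolynomial (monomialsDegLE n d) F))
              ≤ complexity (X j : MvPolynomial (monomialsDegLE n d) F) + 1 :=
                complexity_smul_le_holds _ _
            _ = 1 := by rw [complexity_X_holds]
      _ = 2 * Fintype.card (monomialsDegLE n d) := by simp [two_mul]
  -- degrees of the substituted polynomials
  have hθdeg : ∀ v, (θ v).totalDegree ≤ 1 := by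
    intro v
    rcases v with i | j
    · simp only [hθ, Sum.elim_inl]
      refine (totalDegree_rename_le _ _).trans ?_
      refine totalDegree_finsetSum_le fun j _ => ?_
      exact (totalDegree_smul_le _ _).trans (by rw [totalDegree_X])
    · simp only [hθ, Sum.elim_inr, totalDegree_X, le_refl]
  refine ⟨aeval θ H, ?_, ?_, ?_, ?_⟩
  · -- nonzero
    rw [hkey]
    intro h0
    exact hE0 (linSubst_injective_of_isUnit_det V.transpose hVt (by rw [h0, map_zero]))
  · -- degree
    exact totalDegree_aeval_le_of_le_one θ hθdeg H
  · -- complexity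
    calc complexity (aeval θ H) ≤ complexity H + ∑ v, complexity (θ v) := complexity_aeval_le _ _
      _ = complexity H + (∑ i, complexity (θ (Sum.inl i)) + ∑ j, complexity (θ (Sum.inr j))) := by
          rw [Fintype.sum_sum_type]
      _ ≤ complexity H + (∑ _i : monomialsDegLE n d, 2 * Fintype.card (monomialsDegLE n d) +
            ∑ _j : Fin q, 0) := by
          gcongr with i _ j _
          · simp only [hθ, Sum.elim_inl]
            exact (complexity_rename_le_holds' _ _).trans (hℓcx i)
          · simp only [hθ, Sum.elim_inr]
            exact (complexity_X_holds _).le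
      _ = complexity H + 2 * Fintype.card (monomialsDegLE n d) ^ 2 := by simp [sq]; ring
  · -- vanishing on coefficient vectors
    intro f hf
    rw [hkey, eval_linSubst_transpose, hVdef, ← evalVector_eq_mulVec F (h𝒞 f hf)]
    exact hE f hf

end PropFourSix

/-! ## §2 The engine: `VP_n`-succinct hitting against `VNP(N)` turns projection-circuit equations
into a `VPSPACE⁰_b` family outside `VNP` (Chatterjee–Tengse §4.3, second case, `𝒟 = VNP`) -/

section Engine

variable (F : Type) [Field F]

/-- **Separation engine.**  Data over a field `F` of characteristic `0`: classes `S n` of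
degree-`≤ n` polynomials; for all large ("good") `n` a nonzero multilinear integer polynomial
`P_n` in the evaluation coordinates `x^{≤ n}` with a constant-free fan-in-two projection circuit
of size `≤ 2^n` over `≤ 2^n` workspace variables, vanishing at the evaluation vectors of `S n`;
and the HITTING hypothesis: for every level `a`, for infinitely many `n`, every nonzero level-`a`
Boolean sum (`q, L(H), deg H ≤ N^a`, `N = C(2n,n)`) is nonzero at the coefficient vector of some
member of `S n`.  Conclusion: the integer family `N ↦ P_{⌊log₄ N⌋}` (zero below the thresholds)
is in `VPSPACE⁰_b` (`IsVPSPACE0bFamily`: `≤ N + 1` variables, gates and workspace variables,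
degree `≤ N + 1`) and its image over `F` is NOT in `VNP_F` (`¬ IsVNPFamily`).  Proof: if
`P ⊗ F = boolSum g` with `g ∈ VP_F` (p-bounds `N^e + e` on the Boolean block, `L(g_N)`, `deg g_N`),
pick by the hitting hypothesis a good `n ≥ 1` hit at level `2e+4`; at `N = 4^n`,
`boolSum (g (4^n)) = P_n ⊗ F` is a nonzero equation for the EVALUATION vectors of `S n` with data
`≤ (4^n)^e + e ≤ C(2n,n)^(2e+1)` (`bound_le_level`); §1 pulls it back to a nonzero Boolean-sum
equation for the COEFFICIENT vectors of `S n` of level `≤ 2e+4` (`add_two_sq_le_pow`) — hit,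
contradiction.  [cite: ChatterjeeTengse2023, Thm. 1.1 last clause and §4.3 (v1: p0019.txt:L6–L8)] -/
theorem exists_isVPSPACE0bFamily_not_isVNPFamily [CharZero F]
    (S : ∀ n : ℕ, Set (MvPolynomial (Fin n) F)) (hS : ∀ n, ∀ f ∈ S n, f.totalDegree ≤ n)
    (good : ℕ → Prop)
    (hdata : ∀ n, good n → ∃ (t : ℕ) (P : MvPolynomial (degLEMonomials n) ℤ)
        (Q : ProjCircuit ℤ (degLEMonomials n ⊕ Fin t)),
        P ≠ 0 ∧ (∀ v, P.degreeOf v ≤ 1) ∧ Q.IsFanInTwo ∧ Q.HasSignConstants ∧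
          Q.Computes (rename Sum.inl P) ∧ t ≤ 2 ^ n ∧ Q.size ≤ 2 ^ n ∧
          ∀ f ∈ S n, eval (evalVector F n f) (MvPolynomial.map (Int.castRingHom F) P) = 0)
    (hgood : ∃ n₁ : ℕ, ∀ n ≥ n₁, good n)
    (hhit : ∀ a n₀ : ℕ, ∃ n : ℕ, n₀ ≤ n ∧ ∀ q : ℕ, q ≤ ((2 * n).choose n) ^ a →
        ∀ H : MvPolynomial (degLEMonomials n ⊕ Fin q) F,
          complexity H ≤ ((2 * n).choose n) ^ a → H.totalDegree ≤ ((2 * n).choose n) ^ a →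
          boolSum H ≠ 0 → ∃ f ∈ S n, eval (coeffVector (degLEMonomials n) f) (boolSum H) ≠ 0) :
    ∃ P : ∀ N : ℕ, MvPolynomial (degLEMonomials (Nat.log 4 N)) ℤ,
      IsVPSPACE0bFamily P ∧
        ¬ IsVNPFamily (fun N => MvPolynomial.map (Int.castRingHom F) (P N)) := by
  classical
  -- level data with UNIFORM bounds (`≤ 2^n`), the zero polynomial below the thresholds
  have hLD : ∀ n : ℕ, ∃ (t : ℕ) (P : MvPolynomial (degLEMonomials n) ℤ)
      (Q : ProjCircuit ℤ (degLEMonomials n ⊕ Fin t)),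
      Q.IsFanInTwo ∧ Q.HasSignConstants ∧ Q.Computes (rename Sum.inl P) ∧
        (∀ v, P.degreeOf v ≤ 1) ∧ t ≤ 2 ^ n ∧ Q.size ≤ 2 ^ n ∧
        (good n → P ≠ 0 ∧
          ∀ f ∈ S n, eval (evalVector F n f) (MvPolynomial.map (Int.castRingHom F) P) = 0) := by
    intro n
    by_cases hg : good n
    · obtain ⟨t, P, Q, hP0, hPml, hQ2, hQsc, hQc, ht, hQs, hvan⟩ := hdata n hg
      exact ⟨t, P, Q, hQ2, hQsc, hQc, hPml, ht, hQs, fun _ => ⟨hP0, hvan⟩⟩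
    · refine ⟨0, 0, ProjCircuit.ofArithCircuit (ArithCircuit.ofConst 0), ?_, ?_, ?_, ?_,
        Nat.zero_le _, ?_, fun hg' => absurd hg' hg⟩
      · intro g hg'
        simp [ProjCircuit.ofArithCircuit, ArithCircuit.ofConst] at hg'
      · refine ProjCircuit.hasSignConstants_ofArithCircuit ⟨?_, ?_⟩
        · intro g hg'
          simp [ArithCircuit.ofConst] at hg'
        · show ArithCircuit.IsSignConstant (0 : ℤ)
          exact Or.inl rfl
      · show (ProjCircuit.ofArithCircuit (ArithCircuit.ofConst (0 : ℤ))).eval = rename Sum.inl 0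
        rw [ProjCircuit.eval_ofArithCircuit, ArithCircuit.eval_ofConst, map_zero, map_zero]
      · intro v
        rw [degreeOf_zero]
        exact Nat.zero_le _
      · rw [ProjCircuit.size_ofArithCircuit, ArithCircuit.size_ofConst]
        exact Nat.zero_le _
  choose t P Q h2 hsc hcomp hml ht hsize hP using hLD
  refine ⟨fun N => P (Nat.log 4 N), ⟨⟨⟨1, fun N => by simpa using card_degLEMonomials_log_le N⟩,
    fun N => t (Nat.log 4 N), fun N => Q (Nat.log 4 N), ⟨1, fun N => ?_⟩,
    fun N => ⟨h2 _, hsc _, hcomp _⟩, ⟨1, fun N => ?_⟩⟩, ⟨1, fun N => ?_⟩⟩, ?_⟩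
  · -- workspace variables
    simpa using (ht (Nat.log 4 N)).trans (two_pow_log_four_le N)
  · -- size
    simpa using (hsize (Nat.log 4 N)).trans (two_pow_log_four_le N)
  · -- degree
    simpa using (totalDegree_le_card_of_degreeOf_le_one (hml (Nat.log 4 N))).trans
      (card_degLEMonomials_log_le N)
  · -- not in `VNP_F`
    rintro ⟨-, u, g, ⟨⟨⟨e₁, he₁⟩, ⟨e₂, he₂⟩⟩, ⟨e₃, he₃⟩⟩, hsum⟩
    obtain ⟨n₁, hn₁⟩ := hgood
    set e := max e₁ (max e₂ e₃) with hedef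
    -- a hit level absorbing the p-bounds of `g` and the pull-back cost
    obtain ⟨n, hn, hhitn⟩ := hhit (2 * e + 1 + 3) (max n₁ 1)
    have hgoodn : good n := hn₁ n (le_trans (le_max_left _ _) hn)
    have h1n : 1 ≤ n := le_trans (le_max_right _ _) hn
    obtain ⟨hP0, hvan⟩ := hP n hgoodn
    set C := (2 * n).choose n with hCdef
    have hC2 : 2 ≤ C :=
      calc (2 : ℕ) = 2 ^ 1 := (pow_one 2).symm
        _ ≤ 2 ^ n := Nat.pow_le_pow_right (by norm_num) h1n
        _ ≤ C := Literature.ModelTheory.FiniteModelTheory.two_pow_le_choose_two_mul_self n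
    -- the Boolean-sum datum at `N = 4^n`, transported to the index `n`
    have hΦ : ∃ q : ℕ, q ≤ (4 ^ n) ^ e₁ + e₁ ∧
        ∃ H : MvPolynomial (degLEMonomials (Nat.log 4 (4 ^ n)) ⊕ Fin q) F,
          complexity H ≤ (4 ^ n) ^ e₃ + e₃ ∧ H.totalDegree ≤ (4 ^ n) ^ e₂ + e₂ ∧
          boolSum H = MvPolynomial.map (Int.castRingHom F) (P (Nat.log 4 (4 ^ n))) := by
      refine ⟨u (4 ^ n), ?_, g (4 ^ n), he₃ (4 ^ n), he₂ (4 ^ n), (hsum (4 ^ n)).symm⟩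
      have h := he₁ (4 ^ n)
      simp only [Fintype.card_sum, Fintype.card_fin] at h
      omega
    rw [Nat.log_pow (by norm_num : 1 < 4)] at hΦ
    obtain ⟨q, hq, H, hHc, hHd, hHsum⟩ := hΦ
    -- absorb the p-bounds into the level `2e+1`
    have hmono : ∀ {i : ℕ}, i ≤ e → (4 ^ n) ^ i + i ≤ C ^ (2 * e + 1) := by
      intro i hi
      calc (4 ^ n) ^ i + i ≤ (4 ^ n) ^ e + e :=
            Nat.add_le_add (Nat.pow_le_pow_right (by positivity) hi) hi
        _ ≤ C ^ (2 * e + 1) := bound_le_level h1n e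
    have hq' : q ≤ C ^ (2 * e + 1) := hq.trans (hmono (le_max_left _ _))
    have hHc' : complexity H ≤ C ^ (2 * e + 1) :=
      hHc.trans (hmono ((le_max_right _ _).trans (le_max_right _ _)))
    have hHd' : H.totalDegree ≤ C ^ (2 * e + 1) :=
      hHd.trans (hmono ((le_max_left _ _).trans (le_max_right _ _)))
    -- `boolSum H = P_n ⊗ F` is a nonzero equation for the EVALUATION vectors of `S n`
    have hE0 : boolSum H ≠ 0 := by
      rw [hHsum]
      intro h0
      exact hP0 (MvPolynomial.map_injective (Int.castRingHom F) (Int.castRingHom F).injective_int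
        (by rw [h0, map_zero]))
    have hEq : (boolSum H : MvPolynomial (monomialsDegLE n n) F) =
        MvPolynomial.map (Int.castRingHom F) (P n) := hHsum
    have hEvan : ∀ f ∈ S n, eval (evalVector F n f) (boolSum H) = 0 := by
      intro f hf; rw [hEq]; exact hvan f hf
    -- pull back to the COEFFICIENT vectors (§1)
    letI : Fintype (monomialsDegLE n n) := degLEMonomials.instFintype n
    obtain ⟨H', hH'0, hH'd, hH'c, hH'van⟩ :=
      exists_coeffBoolSum_of_evalBoolSum F (S n) (hS n) H hE0 hEvan
    have hcard : Fintype.card (monomialsDegLE n n) = C := BarrierLever.NaturalProofsSeparateVNP.SignSlice.fintypeCard_degLEMonomials n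
    rw [hcard] at hH'c
    -- the hit at level `2e+4`
    have hpow : C ^ (2 * e + 1) ≤ C ^ (2 * e + 1 + 3) := Nat.pow_le_pow_right (by omega) (by omega)
    obtain ⟨f, hf, hne⟩ := hhitn q (hq'.trans hpow) H'
      ((hH'c.trans (Nat.add_le_add_right hHc' _)).trans (add_two_sq_le_pow hC2 (by omega) le_rfl))
      ((hH'd.trans hHd').trans hpow) hH'0
    exact hne (hH'van f hf)

/-- `VP ⊆ VNP` transfers the separation: a family outside `VNP_F` is outside `VP_F`. [folklore] -/
theorem not_isVPFamily_of_not_isVNPFamily {σ : ℕ → Type} [∀ N, Fintype (σ N)]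
    {f : ∀ N, MvPolynomial (σ N) F} (h : ¬ IsVNPFamily f) : ¬ IsVPFamily f :=
  fun hVP => h (IsVPFamily.isVNPFamily_holds' hVP)

end Engine

end VNPVersusVPSPACE

end Summit.ValiantsHypothesis.ValiantsHypothesis.Theorems.BarrierLeverDefinableEquations
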